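import Mathlib
import HarnessLib

/-!
# Route `IntegerScrew` — the fibre Poincaré inequality of the truncated multiplicative walk

For a prime `p` split `x ≤ M` as `x = p^{v_p(x)} · u`, `u = ordCompl[p] x` (`p ∤ u`), and let
`F_u = {x ≤ M : ordCompl[p] x = u}` be the `p`-FIBRE over `u`, with the harmonic weights `1/x` of the walk's
reversible measure.  The `p`-part of the (t-time, unnormalised) Dirichlet form of the truncated multiplicative
walk of PROP. N4 (`IntegerScrewWalkGenerator` / `IntegerScrewWalkDirichlet`; every death `x → x/p^a`,
`1 ≤ a ≤ v_p(x)`, has rate `Λ(p^a) = log p`),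

`D_p(g) = Σ_{x ≤ M} (1/x) · Σ_{a=1}^{v_p(x)} log p · (g(x) − g(x/p^a))²`,

dominates `log p` times the conditional variance of `g` given the `p`-free part:

* `sum_sum_mul_sq_sub`, `two_mul_sum_sum_lt` — the pair-sum form of a weighted variance (algebra);
* `fibre_sum_deaths_eq` — on a fibre, the deaths `x → x/p^a` (`1 ≤ a ≤ v_p(x)`) are exactly the moves to the
  smaller fibre elements `y < x`;
* **`fibre_poincare_one`**, **`fibre_poincare`** —
  `log p · Σ_u u·(Z_u·Σ_{F_u} g²/x − (Σ_{F_u} g/x)²) ≤ D_p(g)`, `Z_u = Σ_{F_u} 1/x`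
  (one line per fibre: `(1/x)(g x − g y)² ≥ (u/(xy))(g x − g y)²` for `y ∈ F_u`, since `u ≤ y`);
* **`fibre_poincare_condVar`** — hence `log p · Σ_u (Σ_{F_u} g²/x − (Σ_{F_u} g/x)²/Z_u) ≤ D_p(g)`:
  conditionally on the `p`-free part, the `p`-coordinate of the walk has spectral gap `≥ log p · u·Z_u ≥ log p`
  (t-units); `u·Z_u = Σ_{v ≤ V(u)} p^{−v} → p/(p−1)` on long fibres, i.e. the bound tends to the `{p}`-level
  `λ_{p} = p log p/(p−1)` of the prime-parity ladder (PIVOT-LAW 13.10 (iv)).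

This is the tensorisation input of the Poincaré (lower-bound) side of the ladder (CONTINUUM-LIMIT §24): in the
top-down martingale decomposition of `Var_π(g)` it bounds every level's MAIN term by `D_p(g)/log p`.
RH-free and elementary.

References: PIVOT-LAW §13.10, CONTINUUM-LIMIT §23.18/§24 (rh-explicit A6-PIVOT); M. Suzuki, J. Lond. Math.
Soc. (2) 108 (2023) 1448–1487 [Suzuki2023] (the walk is the probabilistic model of the screw-criterion window
problem).
-/

noncomputable section

set_option linter.dupNamespace false -- D-0017: `Summit.<S>.<S>.…` is the designed namespace

namespace Summit.RiemannHypothesis.RiemannHypothesis.Theorems.IntegerScrew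

open Finset

/-! ### Algebra: the pair-sum form of a weighted variance -/

/-- `Σ_x Σ_y w_x w_y (g_x − g_y)² = 2·(Z·Σ_x w_x g_x² − (Σ_x w_x g_x)²)` with `Z = Σ_x w_x`. -/
theorem sum_sum_mul_sq_sub (s : Finset ℕ) (w g : ℕ → ℝ) :
    ∑ x ∈ s, ∑ y ∈ s, w x * w y * (g x - g y) ^ 2 =
      2 * ((∑ x ∈ s, w x) * (∑ x ∈ s, w x * g x ^ 2) - (∑ x ∈ s, w x * g x) ^ 2) := by
  have h : ∀ x ∈ s, ∑ y ∈ s, w x * w y * (g x - g y) ^ 2 =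
      (w x * g x ^ 2) * (∑ y ∈ s, w y) - (2 * (w x * g x)) * (∑ y ∈ s, w y * g y)
        + w x * (∑ y ∈ s, w y * g y ^ 2) := by
    intro x _
    rw [Finset.mul_sum, Finset.mul_sum, Finset.mul_sum, ← Finset.sum_sub_distrib,
      ← Finset.sum_add_distrib]
    exact Finset.sum_congr rfl fun y _ => by ring
  rw [Finset.sum_congr rfl h, Finset.sum_add_distrib, Finset.sum_sub_distrib, ← Finset.sum_mul,
    ← Finset.sum_mul, ← Finset.sum_mul, ← Finset.mul_sum]
  ring

/-- For a symmetric `S` vanishing on the diagonal, `2·Σ_x Σ_{y<x} S x y = Σ_x Σ_y S x y`. -/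
theorem two_mul_sum_sum_lt (s : Finset ℕ) (S : ℕ → ℕ → ℝ) (hsymm : ∀ x y, S x y = S y x)
    (hdiag : ∀ x, S x x = 0) :
    2 * ∑ x ∈ s, ∑ y ∈ s with y < x, S x y = ∑ x ∈ s, ∑ y ∈ s, S x y := by
  have hpt : ∀ x y, S x y = (if y < x then S x y else 0) + (if x < y then S x y else 0) := by
    intro x y
    rcases lt_trichotomy y x with h | h | h
    · simp [h, not_lt.2 h.le]
    · subst h; simp [hdiag]
    · simp [h, not_lt.2 h.le]
  have h1 : ∑ x ∈ s, ∑ y ∈ s, S x y =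
      ∑ x ∈ s, ∑ y ∈ s, (if y < x then S x y else 0)
        + ∑ x ∈ s, ∑ y ∈ s, (if x < y then S x y else 0) := by
    rw [← Finset.sum_add_distrib]
    refine Finset.sum_congr rfl fun x _ => ?_
    rw [← Finset.sum_add_distrib]
    exact Finset.sum_congr rfl fun y _ => hpt x y
  have h2 : ∑ x ∈ s, ∑ y ∈ s, (if x < y then S x y else 0) =
      ∑ x ∈ s, ∑ y ∈ s, (if y < x then S x y else 0) := by
    rw [Finset.sum_comm]
    refine Finset.sum_congr rfl fun x _ => Finset.sum_congr rfl fun y _ => ?_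
    rw [hsymm]
  rw [h1, h2, ← two_mul]
  congr 1
  refine Finset.sum_congr rfl fun x _ => ?_
  rw [Finset.sum_filter]

/-! ### The fibre and its deaths -/

/-- On the `p`-fibre `F_u` of `x` (`ordCompl[p] x = u`), the deaths `x → x/p^a`, `1 ≤ a ≤ v_p(x)`, are exactly
the moves to the fibre elements `y < x`. -/
theorem fibre_sum_deaths_eq {M p : ℕ} (hp : p.Prime) {u x : ℕ}
    (hx : x ∈ (Icc 1 M).filter (fun x => ordCompl[p] x = u)) (f : ℕ → ℝ) :
    ∑ a ∈ Icc 1 (x.factorization p), f (x / p ^ a) =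
      ∑ y ∈ ((Icc 1 M).filter (fun x => ordCompl[p] x = u)) with y < x, f y := by
  obtain ⟨hxI, hxu⟩ := mem_filter.1 hx
  have hx1 : 1 ≤ x := (mem_Icc.1 hxI).1
  have hxM : x ≤ M := (mem_Icc.1 hxI).2
  have hx0 : x ≠ 0 := by omega
  -- `x = p^{v_p x} · u`
  have hxdec : p ^ x.factorization p * u = x := by rw [← hxu]; exact Nat.ordProj_mul_ordCompl_eq_self x p
  refine Finset.sum_nbij' (fun a => x / p ^ a) (fun y => x.factorization p - y.factorization p)
    ?_ ?_ ?_ ?_ ?_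
  · -- maps into the fibre, below `x`
    intro a ha
    obtain ⟨ha1, hav⟩ := mem_Icc.1 ha
    have hdvd : p ^ a ∣ x := (hp.pow_dvd_iff_le_factorization hx0).2 hav
    have hpa : 1 < p ^ a := Nat.one_lt_pow (by omega) hp.one_lt
    refine mem_filter.2 ⟨mem_filter.2 ⟨mem_Icc.2 ⟨?_, (Nat.div_le_self x _).trans hxM⟩, ?_⟩,
      Nat.div_lt_self (by omega) hpa⟩
    · exact Nat.div_pos (Nat.le_of_dvd (by omega) hdvd) (by positivity)
    · rw [Nat.ordCompl_div_pow_of_dvd a hp hdvd]; exact hxu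
  · -- the inverse maps into `Icc 1 (v_p x)`
    intro y hy
    obtain ⟨hyF, hyx⟩ := mem_filter.1 hy
    obtain ⟨hyI, hyu⟩ := mem_filter.1 hyF
    have hydec : p ^ y.factorization p * u = y := by
      rw [← hyu]; exact Nat.ordProj_mul_ordCompl_eq_self y p
    have hlt : y.factorization p < x.factorization p := by
      by_contra hle
      push Not at hle
      have : x ≤ y := by
        rw [← hxdec, ← hydec]
        exact Nat.mul_le_mul_right u (Nat.pow_le_pow_right hp.pos hle)
      omega
    exact mem_Icc.2 ⟨by omega, Nat.sub_le _ _⟩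
  · -- left inverse
    intro a ha
    obtain ⟨ha1, hav⟩ := mem_Icc.1 ha
    have hdvd : p ^ a ∣ x := (hp.pow_dvd_iff_le_factorization hx0).2 hav
    have hva : (x / p ^ a).factorization p = x.factorization p - a := by
      rw [Nat.factorization_div hdvd, Finsupp.tsub_apply, Nat.factorization_pow_self hp]
    rw [hva]
    omega
  · -- right inverse
    intro y hy
    obtain ⟨hyF, hyx⟩ := mem_filter.1 hy
    obtain ⟨hyI, hyu⟩ := mem_filter.1 hyF
    have hydec : p ^ y.factorization p * u = y := by
      rw [← hyu]; exact Nat.ordProj_mul_ordCompl_eq_self y p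
    have hle : y.factorization p ≤ x.factorization p := by
      by_contra hlt
      push Not at hlt
      have : x ≤ y := by
        rw [← hxdec, ← hydec]
        exact Nat.mul_le_mul_right u (Nat.pow_le_pow_right hp.pos hlt.le)
      omega
    have hxy : x = p ^ (x.factorization p - y.factorization p) * y := by
      have h' : p ^ (x.factorization p - y.factorization p) * y = p ^ x.factorization p * u := by
        calc p ^ (x.factorization p - y.factorization p) * y
            = p ^ (x.factorization p - y.factorization p) * (p ^ y.factorization p * u) := by rw [hydec]
          _ = p ^ (x.factorization p - y.factorization p + y.factorization p) * u := by rw [pow_add]; ring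
          _ = p ^ x.factorization p * u := by rw [Nat.sub_add_cancel hle]
      rw [h', hxdec]
    show x / p ^ (x.factorization p - y.factorization p) = y
    exact Nat.div_eq_of_eq_mul_right (pow_pos hp.pos _) hxy
  · intro a _; rfl

/-! ### The fibre Poincaré inequality -/

/-- **Fibre Poincaré inequality, one fibre.**  For `p` prime, any `u` and the fibre
`F = {x ≤ M : ordCompl[p] x = u}` (empty unless `p ∤ u`, `1 ≤ u ≤ M`) with `Z = Σ_F 1/x`:
`log p · u · (Z·Σ_F g²/x − (Σ_F g/x)²) ≤ Σ_{x∈F} (1/x) Σ_{a=1}^{v_p(x)} log p (g x − g(x/p^a))²`. -/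
theorem fibre_poincare_one {M p : ℕ} (hp : p.Prime) (g : ℕ → ℝ) (u : ℕ) :
    Real.log p * ((u : ℝ) *
        ((∑ x ∈ (Icc 1 M).filter (fun x => ordCompl[p] x = u), 1 / (x : ℝ)) *
            (∑ x ∈ (Icc 1 M).filter (fun x => ordCompl[p] x = u), 1 / (x : ℝ) * g x ^ 2) -
          (∑ x ∈ (Icc 1 M).filter (fun x => ordCompl[p] x = u), 1 / (x : ℝ) * g x) ^ 2)) ≤
      ∑ x ∈ (Icc 1 M).filter (fun x => ordCompl[p] x = u),
        1 / (x : ℝ) * ∑ a ∈ Icc 1 (x.factorization p), Real.log p * (g x - g (x / p ^ a)) ^ 2 := by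
  set F := (Icc 1 M).filter (fun x => ordCompl[p] x = u) with hF
  have hlogp : 0 ≤ Real.log p := Real.log_nonneg (by exact_mod_cast hp.one_lt.le)
  -- members of the fibre are multiples of `u`, hence `≥ u`, and positive
  have hmem : ∀ y ∈ F, 0 < y ∧ u ≤ y := by
    intro y hy
    obtain ⟨hyI, hyu⟩ := mem_filter.1 hy
    have hy1 : 1 ≤ y := (mem_Icc.1 hyI).1
    refine ⟨by omega, Nat.le_of_dvd (by omega) ?_⟩
    rw [← hyu]; exact Nat.ordCompl_dvd y p
  -- the pair-sum form of the left-hand side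
  have hpair : Real.log p * ((u : ℝ) *
      ((∑ x ∈ F, 1 / (x : ℝ)) * (∑ x ∈ F, 1 / (x : ℝ) * g x ^ 2) - (∑ x ∈ F, 1 / (x : ℝ) * g x) ^ 2)) =
      ∑ x ∈ F, ∑ y ∈ F with y < x, (Real.log p * u) * (1 / (x : ℝ) * (1 / (y : ℝ)) * (g x - g y) ^ 2) := by
    have h2 := two_mul_sum_sum_lt F (fun x y => 1 / (x : ℝ) * (1 / (y : ℝ)) * (g x - g y) ^ 2)
      (fun x y => by ring) (fun x => by ring)
    rw [sum_sum_mul_sq_sub F (fun x => 1 / (x : ℝ)) g] at h2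
    have h3 : ∑ x ∈ F, ∑ y ∈ F with y < x, 1 / (x : ℝ) * (1 / (y : ℝ)) * (g x - g y) ^ 2 =
        (∑ x ∈ F, 1 / (x : ℝ)) * (∑ x ∈ F, 1 / (x : ℝ) * g x ^ 2) - (∑ x ∈ F, 1 / (x : ℝ) * g x) ^ 2 := by
      linarith
    rw [← h3]
    simp only [Finset.mul_sum]
    exact Finset.sum_congr rfl fun x _ => Finset.sum_congr rfl fun y _ => by ring
  rw [hpair]
  refine Finset.sum_le_sum fun x hx => ?_
  rw [fibre_sum_deaths_eq hp hx (fun y => Real.log p * (g x - g y) ^ 2), Finset.mul_sum]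
  refine Finset.sum_le_sum fun y hy => ?_
  obtain ⟨hyF, _⟩ := mem_filter.1 hy
  obtain ⟨hypos, huy⟩ := hmem y hyF
  obtain ⟨hxpos, _⟩ := hmem x hx
  have hy' : (0 : ℝ) < y := by exact_mod_cast hypos
  have huy' : (u : ℝ) * (1 / (y : ℝ)) ≤ 1 := by
    rw [mul_one_div]; exact (div_le_one hy').2 (by exact_mod_cast huy)
  have hnn : 0 ≤ 1 / (x : ℝ) * (Real.log p * (g x - g y) ^ 2) := by positivity
  calc Real.log p * u * (1 / (x : ℝ) * (1 / (y : ℝ)) * (g x - g y) ^ 2)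
      = ((u : ℝ) * (1 / (y : ℝ))) * (1 / (x : ℝ) * (Real.log p * (g x - g y) ^ 2)) := by ring
    _ ≤ 1 * (1 / (x : ℝ) * (Real.log p * (g x - g y) ^ 2)) := mul_le_mul_of_nonneg_right huy' hnn
    _ = 1 / (x : ℝ) * (Real.log p * (g x - g y) ^ 2) := one_mul _

/-- **Fibre Poincaré inequality** (summed over the fibres).  For `p` prime and every `g`:
`log p · Σ_{u ≤ M, p ∤ u} u·(Z_u·Σ_{F_u} g²/x − (Σ_{F_u} g/x)²) ≤ D_p(g)
 = Σ_{x ≤ M} (1/x) Σ_{a=1}^{v_p(x)} log p (g x − g(x/p^a))²`. -/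
theorem fibre_poincare {M p : ℕ} (hp : p.Prime) (g : ℕ → ℝ) :
    Real.log p * ∑ u ∈ (Icc 1 M).filter (fun u => ¬ p ∣ u), ((u : ℝ) *
        ((∑ x ∈ (Icc 1 M).filter (fun x => ordCompl[p] x = u), 1 / (x : ℝ)) *
            (∑ x ∈ (Icc 1 M).filter (fun x => ordCompl[p] x = u), 1 / (x : ℝ) * g x ^ 2) -
          (∑ x ∈ (Icc 1 M).filter (fun x => ordCompl[p] x = u), 1 / (x : ℝ) * g x) ^ 2)) ≤
      ∑ x ∈ Icc 1 M, 1 / (x : ℝ) * ∑ a ∈ Icc 1 (x.factorization p), Real.log p * (g x - g (x / p ^ a)) ^ 2 := by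
  have hmaps : ∀ x ∈ Icc 1 M, ordCompl[p] x ∈ (Icc 1 M).filter (fun u => ¬ p ∣ u) := by
    intro x hx
    have hx1 : 1 ≤ x := (mem_Icc.1 hx).1
    have hx0 : x ≠ 0 := by omega
    exact mem_filter.2 ⟨mem_Icc.2 ⟨Nat.ordCompl_pos p hx0, (Nat.ordCompl_le x p).trans (mem_Icc.1 hx).2⟩,
      Nat.not_dvd_ordCompl hp hx0⟩
  rw [← Finset.sum_fiberwise_of_maps_to hmaps, Finset.mul_sum]
  exact Finset.sum_le_sum fun u _ => fibre_poincare_one hp g u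

/-- **Fibre Poincaré inequality, conditional-variance form**: `log p` times the (harmonic, unnormalised)
conditional variance of `g` given the `p`-free part is at most `D_p(g)`:
`log p · Σ_{u ≤ M, p ∤ u} (Σ_{F_u} g²/x − (Σ_{F_u} g/x)²/Z_u) ≤ D_p(g)`.
(From `fibre_poincare` and `u·Z_u ≥ 1`: the fibre contains `u` itself.) -/
theorem fibre_poincare_condVar {M p : ℕ} (hp : p.Prime) (g : ℕ → ℝ) :
    Real.log p * ∑ u ∈ (Icc 1 M).filter (fun u => ¬ p ∣ u),
        ((∑ x ∈ (Icc 1 M).filter (fun x => ordCompl[p] x = u), 1 / (x : ℝ) * g x ^ 2) -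
          (∑ x ∈ (Icc 1 M).filter (fun x => ordCompl[p] x = u), 1 / (x : ℝ) * g x) ^ 2 /
            (∑ x ∈ (Icc 1 M).filter (fun x => ordCompl[p] x = u), 1 / (x : ℝ))) ≤
      ∑ x ∈ Icc 1 M, 1 / (x : ℝ) * ∑ a ∈ Icc 1 (x.factorization p), Real.log p * (g x - g (x / p ^ a)) ^ 2 := by
  refine le_trans ?_ (fibre_poincare hp g)
  have hlogp : 0 ≤ Real.log p := Real.log_nonneg (by exact_mod_cast hp.one_lt.le)
  refine mul_le_mul_of_nonneg_left (Finset.sum_le_sum fun u hu => ?_) hlogp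
  obtain ⟨huI, hpu⟩ := mem_filter.1 hu
  set F := (Icc 1 M).filter (fun x => ordCompl[p] x = u) with hF
  set Z := ∑ x ∈ F, 1 / (x : ℝ) with hZ
  set S1 := ∑ x ∈ F, 1 / (x : ℝ) * g x with hS1
  set S2 := ∑ x ∈ F, 1 / (x : ℝ) * g x ^ 2 with hS2
  have hu1 : 1 ≤ u := (mem_Icc.1 huI).1
  have hupos : (0 : ℝ) < u := by exact_mod_cast (show 0 < u by omega)
  -- `u ∈ F`, so `Z ≥ 1/u > 0`
  have huF : u ∈ F := by
    refine mem_filter.2 ⟨huI, ?_⟩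
    exact (Nat.ordCompl_eq_self_iff_zero_or_not_dvd u hp).2 (Or.inr hpu)
  have hZge : 1 / (u : ℝ) ≤ Z := by
    have h := Finset.single_le_sum (s := F) (f := fun x : ℕ => 1 / (x : ℝ)) (fun x _ => by positivity) huF
    exact h
  have hZpos : 0 < Z := lt_of_lt_of_le (one_div_pos.2 hupos) hZge
  have huZ : 1 ≤ (u : ℝ) * Z := by
    calc (1 : ℝ) = u * (1 / u) := by field_simp
      _ ≤ u * Z := mul_le_mul_of_nonneg_left hZge hupos.le
  -- the variance is non-negative: `Z·S2 − S1² = ½ ΣΣ w w (g−g)² ≥ 0`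
  have hvar : 0 ≤ Z * S2 - S1 ^ 2 := by
    have h := sum_sum_mul_sq_sub F (fun x => 1 / (x : ℝ)) g
    have hnn : 0 ≤ ∑ x ∈ F, ∑ y ∈ F, 1 / (x : ℝ) * (1 / (y : ℝ)) * (g x - g y) ^ 2 :=
      Finset.sum_nonneg fun x _ => Finset.sum_nonneg fun y _ => by positivity
    rw [h] at hnn
    linarith
  -- `S2 − S1²/Z = (Z S2 − S1²)/Z ≤ u (Z S2 − S1²)`
  have hdiv : S2 - S1 ^ 2 / Z = (Z * S2 - S1 ^ 2) / Z := by
    field_simp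
  rw [hdiv, div_le_iff₀ hZpos]
  calc Z * S2 - S1 ^ 2 = 1 * (Z * S2 - S1 ^ 2) := (one_mul _).symm
    _ ≤ ((u : ℝ) * Z) * (Z * S2 - S1 ^ 2) := mul_le_mul_of_nonneg_right huZ hvar
    _ = (u : ℝ) * (Z * S2 - S1 ^ 2) * Z := by ring

end Summit.RiemannHypothesis.RiemannHypothesis.Theorems.IntegerScrew

end
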